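import Mathlib.Data.List.Chain
import Mathlib.Tactic.Linarith
import HarnessLib

/-!
# Venture HSemireg — soundness of a longest-path potential certificate along walks

Elementary bookkeeping behind the «arithmetic certificate» for the twelve-box window kill of the
computation cell `pub-hsemireg` (seat w1-aut-2, `widen/W1/HANDCERT-TWELVE-w1aut2.md` §3-ter;
second code seat w1-tw-2, `widen/W1/tw2/handcert_x2/`). There, a walk in a «potential graph»
visits nodes `(σ, e)` — a state `σ` (a letter together with a phase) at an integer offset `e` —
every arc `(σ, e) → (τ, e')` satisfies `e' ≤ e + g σ τ` for a tabulated gain `g`, and a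
Bellman–Ford run produces an integer potential `β` with `β σ + g σ τ ≤ β τ` on every arc that
occurs (the relaxation test `feasible_iff_no_relaxation`). The two facts used are:

* `offset_le_potential` — **soundness**: if the walk starts at a node whose offset is within its
  potential, every node on the walk has offset `≤ β`; `offset_le_bound` is the uniform form
  (`β ≤ B` everywhere ⇒ all offsets `≤ B`; in the note `B = 0` resp. `B = 1` for the two box
  families);
* `confined_of_trap` / `walk_stays_in_trap` — **confinement**: if a set `T` of nodes is a TRAP
  for nodes within their potential (every arc into `T` from such a node starts in `T`), then an
  admissible walk that ENDS in `T` lies entirely in `T` (backward propagation along the chain) —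
  the shape of «LEMMA 1 + certificate ⇒ a cancelling word never leaves `K`», after which the
  words inside `K` are listed by hand (LEMMA 2 of the note).

Walks are lists of nodes related consecutively by an arbitrary step relation `R` on `V × ℤ`
(`List.IsChain R`); the only hypotheses on `R` are the gain bound and the feasibility of `β` on
the arcs that occur, both stated inline (no named predicates).

HONEST FRAMING. Order bookkeeping on finite lists of integers only; the Lean index of one step of
a NECESSARY-condition sieve used by the cell. No sheaf, complex, abelian variety or
semiregularity map appears; nothing here says that HC, HC_CM or HC_AV holds, and nothing here is
a new case of anything.
-/

namespace Summit.Ventures.HSemireg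

namespace WalkPotentialBound

variable {V : Type*}

/-- One step carries the potential bound: on an arc `p → q` with offset rise at most the gain
and `β` feasible on that arc, `p.2 ≤ β p.1` implies `q.2 ≤ β q.1`. -/
theorem carries_of_feasible {R : V × ℤ → V × ℤ → Prop} {g : V → V → ℤ} {β : V → ℤ}
    (hgain : ∀ p q, R p q → q.2 ≤ p.2 + g p.1 q.1)
    (hβ : ∀ p q, R p q → β p.1 + g p.1 q.1 ≤ β q.1)
    {p q : V × ℤ} (h : R p q) (hp : p.2 ≤ β p.1) : q.2 ≤ β q.1 := by
  have h1 := hgain p q h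
  have h2 := hβ p q h
  linarith

/-- **Soundness of the potential certificate.** Let `R` be a step relation on nodes
`(state, offset)` whose arcs raise the offset by at most the gain `g`, and `β` a potential that
is feasible (`β σ + g σ τ ≤ β τ`) on every arc that occurs. Along every `R`-walk `p :: w` whose
first node has offset within its potential, every node has offset within its potential. -/
theorem offset_le_potential {R : V × ℤ → V × ℤ → Prop} {g : V → V → ℤ} {β : V → ℤ}
    (hgain : ∀ p q, R p q → q.2 ≤ p.2 + g p.1 q.1)
    (hβ : ∀ p q, R p q → β p.1 + g p.1 q.1 ≤ β q.1)
    {p : V × ℤ} {w : List (V × ℤ)} (hw : List.IsChain R (p :: w)) (hp : p.2 ≤ β p.1) :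
    ∀ q ∈ p :: w, q.2 ≤ β q.1 := by
  intro q hq
  rcases List.mem_cons.mp hq with rfl | hq'
  · exact hp
  · exact hw.cons_induction (fun r : V × ℤ => r.2 ≤ β r.1) w
      (fun x y hxy hx => carries_of_feasible hgain hβ hxy hx) hp q hq'

/-- Uniform form: if moreover `β ≤ B` on all states, every node of such a walk sits at offset
`≤ B`. -/
theorem offset_le_bound {R : V × ℤ → V × ℤ → Prop} {g : V → V → ℤ} {β : V → ℤ}
    (hgain : ∀ p q, R p q → q.2 ≤ p.2 + g p.1 q.1)
    (hβ : ∀ p q, R p q → β p.1 + g p.1 q.1 ≤ β q.1) {B : ℤ} (hB : ∀ v, β v ≤ B)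
    {p : V × ℤ} {w : List (V × ℤ)} (hw : List.IsChain R (p :: w)) (hp : p.2 ≤ β p.1) :
    ∀ q ∈ p :: w, q.2 ≤ B :=
  fun q hq => (offset_le_potential hgain hβ hw hp q hq).trans (hB q.1)

/-- The feasibility hypothesis is exactly «no arc can still be relaxed», the termination test of
a longest-path Bellman–Ford run (restated for the record). -/
theorem feasible_iff_no_relaxation (arc : V → V → Prop) (g : V → V → ℤ) (β : V → ℤ) :
    (∀ u v, arc u v → β u + g u v ≤ β v) ↔ ∀ u v, arc u v → ¬ β v < β u + g u v := by
  simp only [not_lt]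

end WalkPotentialBound

namespace WalkPotentialBound

variable {N : Type*}

/-- **Confinement by a trap.** Let `R` be a step relation on nodes, `P` a property carried
forward along steps (e.g. «offset within the potential», `carries_of_feasible`), and `T` a set
of nodes that is a TRAP under `P`: every step into `T` from a node satisfying `P` starts in `T`.
Then a walk `s :: w` with `P s` whose LAST node lies in `T` lies entirely in `T`. -/
theorem confined_of_trap {R : N → N → Prop} {P T : N → Prop}
    (carries : ∀ ⦃x y : N⦄, R x y → P x → P y)
    (trap : ∀ ⦃x y : N⦄, R x y → P x → T y → T x)
    {s : N} {w : List N} (hw : List.IsChain R (s :: w)) (hs : P s)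
    (hlast : T ((s :: w).getLast (List.cons_ne_nil s w))) :
    ∀ x ∈ s :: w, T x := by
  -- every node satisfies `P`
  have hP : ∀ x ∈ s :: w, P x := by
    intro x hx
    rcases List.mem_cons.mp hx with rfl | hx'
    · exact hs
    · exact hw.cons_induction P w carries hs x hx'
  -- upgrade the chain to the relation `R x y ∧ P x`
  have hw' : List.IsChain (fun x y => R x y ∧ P x) (s :: w) :=
    hw.imp_of_mem_imp fun a b ha _ hab => ⟨hab, hP a ha⟩
  -- propagate `T` backwards from the last node
  exact hw'.backwards_induction T (s :: w) (fun x y hxy hy => trap hxy.1 hxy.2 hy)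
    (fun _ => hlast)

/-- The two facts assembled in the shape the certificate uses: nodes `(state, offset)`, arcs
with gain-bounded offset rise, a potential `β` feasible on the arcs that occur, and a trap `T`
for nodes within their potential; an admissible walk from a node within its potential that ends
in `T` never leaves `T`. -/
theorem walk_stays_in_trap {V : Type*} {R : V × ℤ → V × ℤ → Prop} {g : V → V → ℤ} {β : V → ℤ}
    (hgain : ∀ p q, R p q → q.2 ≤ p.2 + g p.1 q.1)
    (hβ : ∀ p q, R p q → β p.1 + g p.1 q.1 ≤ β q.1) {T : V × ℤ → Prop}
    (trap : ∀ ⦃p q : V × ℤ⦄, R p q → p.2 ≤ β p.1 → T q → T p)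
    {p : V × ℤ} {w : List (V × ℤ)} (hw : List.IsChain R (p :: w))
    (hp : p.2 ≤ β p.1) (hlast : T ((p :: w).getLast (List.cons_ne_nil p w))) :
    ∀ q ∈ p :: w, T q :=
  confined_of_trap (P := fun r : V × ℤ => r.2 ≤ β r.1)
    (fun _ _ hxy hx => carries_of_feasible hgain hβ hxy hx) trap hw hp hlast

end WalkPotentialBound

end Summit.Ventures.HSemireg
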